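import Summits.CriticalPhenomena.CardyFormulaZ2.Theorems.CardyIKTransportIKMixedBoxCrossingQuenchedMixtureDefs

/-!
# Stub `stub_quenchedLogSupermodular` (line `defect-closure-exploration` v7 / ALT line `quenched-chain-fkg`,
# crux `IKMixedBoxCrossing`, stmt-CriticalPhenomena-5911) — layer (L) of the quenched-mixture programme

Support file (`--supports stmt-CriticalPhenomena-5911`): every quenched weight `quenchedW D Λ v` of an admissible
environment `(D, v)` (`v ∈ patterns D`) is LOG-SUPERMODULAR on the black sets,
`quenchedW a * quenchedW b ≤ quenchedW (a ∩ b) * quenchedW (a ∪ b)` (`QuenchedLogSupermodular`, registered signature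
`stub_quenchedLogSupermodular`; exported as `quenchedLogSupermodular` for the sibling FKG step `stub_quenchedHarris`).

Proof.
* If `a ⊄ Λ` or `b ⊄ Λ` the left side vanishes (`quenchedW_eq_zero_of_not_subset`) and the right side is nonnegative:
  each chain weight `chainW |V_K| K (v K) ·` is nonnegative because the local code `V_K = localCode D K` has at least
  two words, `∅` (the all-white colouring has no odd face) and the pattern `v K ≠ ∅` (`two_le_card_localCode`).
* If `a, b ⊆ Λ` then so are `a ∩ b`, `a ∪ b`; the free factors `2^{-|free|}` agree on both sides, the products over
  the components split factorwise (`Finset.prod_mul_distrib`, `Finset.prod_le_prod` with nonnegative factors), and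
  for ONE component the weight `τ ↦ chainW V K w τ` is supported on the chain `∅ ⊆ w ⊆ K` (`w = v K ⊆ K` since local
  codewords are subsets of `K`): if `a ∩ K` or `b ∩ K` is off the chain the left side is `0 ≤` right side, and two
  sets on the chain are comparable, so `{x ∩ y, x ∪ y} = {x, y}` and both sides agree (`chainW_mul_le`).
-/

namespace Summit.CriticalPhenomena.CardyFormulaZ2.Cruxes.IKMixedBoxCrossing.QuenchedChainFKG

open Finset
open Literature.Probability.LatticeModels

/-! ## §1 The local code has at least two words -/

/-- The empty (all-white) local colouring is a local codeword: the all-white colouring has no odd face. -/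
private theorem empty_mem_localCode (D K : Finset (Site 2)) : ∅ ∈ localCode D K := by
  rw [localCode, Finset.mem_filter]
  refine ⟨Finset.empty_mem_powerset _, fun g _ _ => ?_⟩
  have h : (fun x : Site 2 => decide (x ∈ (∅ : Finset (Site 2)))) = fun _ => false := by
    funext x
    simp
  rw [h]
  exact not_isOddFace_white g

/-- Unfolding membership in `patterns D`: on a component, an admissible pattern is a nonempty, non-full local codeword. -/
private theorem mem_localCode_of_mem_patterns {D : Finset (Site 2)} {v : Finset (Site 2) → Finset (Site 2)}
    (hv : v ∈ patterns D) {K : Finset (Site 2)} (hK : K ∈ comps D) :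
    v K ∈ localCode D K ∧ v K ≠ ∅ ∧ v K ≠ K := by
  classical
  rw [patterns, Finset.mem_image] at hv
  obtain ⟨f, hf, rfl⟩ := hv
  rw [Finset.mem_pi] at hf
  have h := hf K hK
  rw [Finset.mem_erase, Finset.mem_erase] at h
  show (if h : K ∈ comps D then f K h else ∅) ∈ localCode D K ∧ (if h : K ∈ comps D then f K h else ∅) ≠ ∅ ∧
    (if h : K ∈ comps D then f K h else ∅) ≠ K
  rw [dif_pos hK]
  exact ⟨h.2.2, h.2.1, h.1⟩

/-- Local codewords are subsets of the component cell set. -/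
private theorem subset_of_mem_localCode {D K τ : Finset (Site 2)} (h : τ ∈ localCode D K) : τ ⊆ K := by
  rw [localCode, Finset.mem_filter, Finset.mem_powerset] at h
  exact h.1

/-- For an admissible pattern, every component's local code has at least the two words `∅` and `v K`. -/
private theorem two_le_card_localCode {D : Finset (Site 2)} {v : Finset (Site 2) → Finset (Site 2)}
    (hv : v ∈ patterns D) {K : Finset (Site 2)} (hK : K ∈ comps D) : 2 ≤ (localCode D K).card := by
  obtain ⟨hvK, hne, -⟩ := mem_localCode_of_mem_patterns hv hK
  have hsub : ({∅, v K} : Finset (Finset (Site 2))) ⊆ localCode D K := by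
    rw [Finset.insert_subset_iff, Finset.singleton_subset_iff]
    exact ⟨empty_mem_localCode D K, hvK⟩
  calc 2 = ({∅, v K} : Finset (Finset (Site 2))).card := (Finset.card_pair hne.symm).symm
    _ ≤ (localCode D K).card := Finset.card_le_card hsub

/-- Hence every quenched weight of an admissible environment is nonnegative. -/
private theorem quenchedW_nonneg {D : Finset (Site 2)} (Λ : Finset (Site 2)) {v : Finset (Site 2) → Finset (Site 2)}
    (hv : v ∈ patterns D) (s : Finset (Site 2)) : 0 ≤ quenchedW D Λ v s := by
  unfold quenchedW
  split_ifs
  · exact mul_nonneg (by positivity)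
      (Finset.prod_nonneg fun K hK => chainW_nonneg (two_le_card_localCode hv hK) _ _ _)
  · exact le_rfl

/-- The quenched weight of a black set inside `Λ`, unfolded. -/
private theorem quenchedW_of_subset (D : Finset (Site 2)) {Λ : Finset (Site 2)} (v : Finset (Site 2) → Finset (Site 2))
    {s : Finset (Site 2)} (hs : s ⊆ Λ) :
    quenchedW D Λ v s = ((1 : ℝ) / 2) ^ (freeCells D Λ).card * ∏ K ∈ comps D, chainW (localCode D K).card K (v K) (s ∩ K) := by
  rw [quenchedW, if_pos hs]

/-! ## §2 One component: the chain weight is log-supermodular -/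

/-- Two sets on the chain `{∅, w, K}` (`w ⊆ K`) are comparable. -/
private theorem chain_comparable {K w x y : Finset (Site 2)} (hw : w ⊆ K) (hx : x = ∅ ∨ x = K ∨ x = w)
    (hy : y = ∅ ∨ y = K ∨ y = w) : x ⊆ y ∨ y ⊆ x := by
  rcases hx with rfl | rfl | rfl
  · exact Or.inl (Finset.empty_subset _)
  · rcases hy with rfl | rfl | rfl
    · exact Or.inr (Finset.empty_subset _)
    · exact Or.inl subset_rfl
    · exact Or.inr hw
  · rcases hy with rfl | rfl | rfl
    · exact Or.inr (Finset.empty_subset _)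
    · exact Or.inl hw
    · exact Or.inl subset_rfl

/-- **One-component log-supermodularity**: a weight supported on a chain of sets (here the three-point chain weight
`chainW V K w`, `w ⊆ K`, `2 ≤ V`) satisfies the FKG lattice condition. -/
private theorem chainW_mul_le {V : ℕ} (hV : 2 ≤ V) {K w : Finset (Site 2)} (hw : w ⊆ K) (x y : Finset (Site 2)) :
    chainW V K w x * chainW V K w y ≤ chainW V K w (x ∩ y) * chainW V K w (x ∪ y) := by
  by_cases hx : x = ∅ ∨ x = K ∨ x = w
  · by_cases hy : y = ∅ ∨ y = K ∨ y = w
    · rcases chain_comparable hw hx hy with h | h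
      · rw [Finset.inter_eq_left.2 h, Finset.union_eq_right.2 h]
      · rw [Finset.inter_eq_right.2 h, Finset.union_eq_left.2 h, mul_comm]
    · rw [chainW_eq_zero (fun h => hy (Or.inl h)) (fun h => hy (Or.inr (Or.inl h)))
        (fun h => hy (Or.inr (Or.inr h))), mul_zero]
      exact mul_nonneg (chainW_nonneg hV _ _ _) (chainW_nonneg hV _ _ _)
  · rw [chainW_eq_zero (fun h => hx (Or.inl h)) (fun h => hx (Or.inr (Or.inl h)))
      (fun h => hx (Or.inr (Or.inr h))), zero_mul]
    exact mul_nonneg (chainW_nonneg hV _ _ _) (chainW_nonneg hV _ _ _)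

/-- Rescaling both sides of an inequality of products by the same nonnegative constant twice. -/
private theorem const_mul_mul_le {c x y z w : ℝ} (hc : 0 ≤ c) (h : x * y ≤ z * w) : c * x * (c * y) ≤ c * z * (c * w) := by
  calc c * x * (c * y) = c * c * (x * y) := by ring
    _ ≤ c * c * (z * w) := mul_le_mul_of_nonneg_left h (mul_nonneg hc hc)
    _ = c * z * (c * w) := by ring

/-! ## §3 The registered stub -/

/-- **(L) Log-supermodularity of the quenched weights** (registered stub `stub_quenchedLogSupermodular` of line
`defect-closure-exploration` v7 / `quenched-chain-fkg`): for `D ⊆ innerVertices Λ`, `v ∈ patterns D` and all black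
sets `a, b`, `quenchedW D Λ v a * quenchedW D Λ v b ≤ quenchedW D Λ v (a ∩ b) * quenchedW D Λ v (a ∪ b)`. -/
theorem stub_quenchedLogSupermodular : QuenchedLogSupermodular := by
  intro D Λ _ v hv a b
  by_cases ha : a ⊆ Λ
  swap
  · rw [quenchedW_eq_zero_of_not_subset v ha, zero_mul]
    exact mul_nonneg (quenchedW_nonneg Λ hv _) (quenchedW_nonneg Λ hv _)
  by_cases hb : b ⊆ Λ
  swap
  · rw [quenchedW_eq_zero_of_not_subset v hb, mul_zero]
    exact mul_nonneg (quenchedW_nonneg Λ hv _) (quenchedW_nonneg Λ hv _)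
  have hab : a ∩ b ⊆ Λ := Finset.inter_subset_left.trans ha
  have hab' : a ∪ b ⊆ Λ := Finset.union_subset ha hb
  rw [quenchedW_of_subset D v ha, quenchedW_of_subset D v hb, quenchedW_of_subset D v hab,
    quenchedW_of_subset D v hab']
  have key :
      (∏ K ∈ comps D, chainW (localCode D K).card K (v K) (a ∩ K)) *
          ∏ K ∈ comps D, chainW (localCode D K).card K (v K) (b ∩ K) ≤
        (∏ K ∈ comps D, chainW (localCode D K).card K (v K) (a ∩ b ∩ K)) *
          ∏ K ∈ comps D, chainW (localCode D K).card K (v K) ((a ∪ b) ∩ K) := by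
    rw [← Finset.prod_mul_distrib, ← Finset.prod_mul_distrib]
    refine Finset.prod_le_prod (fun K hK => ?_) (fun K hK => ?_)
    · exact mul_nonneg (chainW_nonneg (two_le_card_localCode hv hK) _ _ _)
        (chainW_nonneg (two_le_card_localCode hv hK) _ _ _)
    · rw [Finset.inter_inter_distrib_right a b K, Finset.union_inter_distrib_right a b K]
      exact chainW_mul_le (two_le_card_localCode hv hK)
        (subset_of_mem_localCode (mem_localCode_of_mem_patterns hv hK).1) _ _
  exact const_mul_mul_le (by positivity) key

/-- **(L)**, exported under its vocabulary name for the sibling files (alias of `stub_quenchedLogSupermodular`). -/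
theorem quenchedLogSupermodular : QuenchedLogSupermodular := stub_quenchedLogSupermodular

end Summit.CriticalPhenomena.CardyFormulaZ2.Cruxes.IKMixedBoxCrossing.QuenchedChainFKG
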